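import Mathlib.Analysis.InnerProductSpace.Adjoint
import Mathlib.Analysis.Normed.Operator.Compact.Basic
import Mathlib.Algebra.QuadraticDiscriminant
import Mathlib.Analysis.SpecialFunctions.Pow.Continuity
import HarnessLib

/-!
# Ground-state Feynman–Kac: the top of the spectrum of a compact positive self-adjoint operator

Topic `Literature/MathematicalPhysics/QuantumManyBody`; theorems only, Mathlib-generic (real
Hilbert space). The abstract functional analysis behind the Perron–Frobenius part of the proof of
the named fact `Literature.MathematicalPhysics.QuantumManyBody.BoseGas.GroundStateFeynmanKac`
(Reed–Simon IV Thm XIII.44; Glimm–Jaffe Thms 3.3.2–3.3.3; Chung–Zhao (1995) §8.3 (29)–(30)), for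
a bounded operator `T` on a real Hilbert space which is SYMMETRIC (`⟪T x, y⟫ = ⟪x, T y⟫`) and
POSITIVE (`⟪T x, x⟫ ≥ 0`):

* `inner_sq_le_of_pos` — Cauchy–Schwarz for the form `⟪T ·, ·⟫`;
* `norm_map_le_of_rayleigh_le` — a bound `M` for the Rayleigh quotient on a `T`-invariant
  closed subspace bounds `T` there: `‖T x‖ ≤ M ‖x‖`; in particular `‖T‖ = sup ⟪T x, x⟫`;
* `exists_rayleigh_gt` — approximate maximisers of the Rayleigh quotient;
* `eq_smul_of_rayleigh_eq_norm` — a maximiser of the Rayleigh quotient is an eigenvector for `‖T‖`;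
* `exists_eigenvector_norm_of_isCompactOperator` — **a nonzero compact positive symmetric
  operator has a unit eigenvector for the eigenvalue `‖T‖`**, more generally inside any closed
  invariant subspace on which the Rayleigh quotient approaches `‖T‖` (maximising sequence,
  compactness);
* `exists_gap_of_simple` — **spectral gap**: if the `‖T‖`-eigenspace is spanned by a unit vector
  `e`, then `‖T x‖ ≤ M₁ ‖x‖` on `e^⊥` for some `M₁ < ‖T‖`.

## References

* M. Reed, B. Simon, *Methods of Modern Mathematical Physics IV* (1978), Thm XIII.44;
  vol. I Thm VI.16 (Hilbert–Schmidt theorem). [ReedSimonIV1978]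
* J. Glimm, A. Jaffe, *Quantum Physics* (1987), §3.3.
-/

noncomputable section

namespace Literature.MathematicalPhysics.QuantumManyBody.BoseGas

open Filter Set Metric
open scoped Topology InnerProductSpace

variable {E : Type*} [NormedAddCommGroup E] [InnerProductSpace ℝ E]

/-! ### Cauchy–Schwarz for a positive symmetric form -/

/-- **Cauchy–Schwarz for the form `⟪T ·, ·⟫`** of a positive symmetric operator:
`⟪T x, y⟫² ≤ ⟪T x, x⟫ ⟪T y, y⟫` (discriminant of `s ↦ ⟪T (x + s y), x + s y⟫ ≥ 0`). [folklore] -/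
theorem inner_sq_le_of_pos (T : E →L[ℝ] E) (hsym : ∀ x y, ⟪T x, y⟫_ℝ = ⟪x, T y⟫_ℝ)
    (hpos : ∀ x, 0 ≤ ⟪T x, x⟫_ℝ) (x y : E) :
    ⟪T x, y⟫_ℝ ^ 2 ≤ ⟪T x, x⟫_ℝ * ⟪T y, y⟫_ℝ := by
  have hq : ∀ s : ℝ, 0 ≤ ⟪T y, y⟫_ℝ * (s * s) + 2 * ⟪T x, y⟫_ℝ * s + ⟪T x, x⟫_ℝ := by
    intro s
    have h := hpos (x + s • y)
    have hxy : ⟪T y, x⟫_ℝ = ⟪T x, y⟫_ℝ := by rw [hsym y x, real_inner_comm]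
    rw [map_add, map_smul, inner_add_left, inner_add_right, inner_add_right, inner_smul_left,
      inner_smul_left, inner_smul_right, inner_smul_right, hxy] at h
    simp only [conj_trivial] at h
    nlinarith [h]
  have hd := discrim_le_zero hq
  rw [discrim] at hd
  nlinarith [hd]

/-! ### The Rayleigh quotient controls the norm -/

/-- **A Rayleigh bound on an invariant closed subspace bounds the operator there**: if `V` is a
`T`-invariant subset closed under scalars, `0 ≤ M` and `⟪T x, x⟫ ≤ M` for all unit `x ∈ V`, then
`‖T x‖ ≤ M ‖x‖` for all `x ∈ V` (`‖Tx‖⁴ = ⟪Tx, Tx⟫² ≤ ⟪Tx, x⟫ ⟪T²x, Tx⟫ ≤ M‖x‖² · M‖Tx‖²`).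
[folklore] -/
theorem norm_map_le_of_rayleigh_le (T : E →L[ℝ] E) (hsym : ∀ x y, ⟪T x, y⟫_ℝ = ⟪x, T y⟫_ℝ)
    (hpos : ∀ x, 0 ≤ ⟪T x, x⟫_ℝ) {V : Set E} (hV : ∀ x ∈ V, T x ∈ V)
    (hVs : ∀ (c : ℝ), ∀ x ∈ V, c • x ∈ V) {M : ℝ} (hM : 0 ≤ M)
    (hR : ∀ x ∈ V, ‖x‖ = 1 → ⟪T x, x⟫_ℝ ≤ M) {x : E} (hx : x ∈ V) : ‖T x‖ ≤ M * ‖x‖ := by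
  -- Rayleigh bound for arbitrary vectors of `V`
  have hR' : ∀ z ∈ V, ⟪T z, z⟫_ℝ ≤ M * ‖z‖ ^ 2 := by
    intro z hz
    rcases eq_or_ne z 0 with rfl | hz0
    · simp
    · have hzn : 0 < ‖z‖ := norm_pos_iff.2 hz0
      have hu : ‖‖z‖⁻¹ • z‖ = 1 := by
        rw [norm_smul, norm_inv, norm_norm, inv_mul_cancel₀ hzn.ne']
      have h := hR _ (hVs _ z hz) hu
      rw [map_smul, inner_smul_left, inner_smul_right, conj_trivial] at h
      have : ⟪T z, z⟫_ℝ = ‖z‖ ^ 2 * (‖z‖⁻¹ * (‖z‖⁻¹ * ⟪T z, z⟫_ℝ)) := by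
        field_simp
      rw [this]
      nlinarith [h, sq_nonneg ‖z‖]
  -- `‖Tx‖⁴ ≤ ⟪Tx, x⟫ ⟪T(Tx), Tx⟫ ≤ M ‖x‖² · M ‖Tx‖²`
  have h1 : (‖T x‖ ^ 2) ^ 2 ≤ ⟪T x, x⟫_ℝ * ⟪T (T x), T x⟫_ℝ := by
    have h := inner_sq_le_of_pos T hsym hpos x (T x)
    rwa [real_inner_self_eq_norm_sq] at h
  have h2 : ⟪T x, x⟫_ℝ * ⟪T (T x), T x⟫_ℝ ≤ (M * ‖x‖ ^ 2) * (M * ‖T x‖ ^ 2) :=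
    mul_le_mul (hR' x hx) (hR' (T x) (hV x hx)) (hpos _) (by positivity)
  have h3 : (‖T x‖ ^ 2) ^ 2 ≤ (M * ‖x‖) ^ 2 * ‖T x‖ ^ 2 := by nlinarith [h1, h2]
  by_cases hTx : ‖T x‖ = 0
  · rw [hTx]; positivity
  · have hTx' : 0 < ‖T x‖ ^ 2 := by positivity
    have h4 : ‖T x‖ ^ 2 ≤ (M * ‖x‖) ^ 2 := le_of_mul_le_mul_right (by nlinarith [h3]) hTx'
    exact (pow_le_pow_iff_left₀ (norm_nonneg _) (mul_nonneg hM (norm_nonneg _)) two_ne_zero).1 h4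

/-- **`‖T‖` is the supremum of the Rayleigh quotient** (upper half): if `⟪T x, x⟫ ≤ M` for all unit
`x` (`M ≥ 0`) then `‖T‖ ≤ M`. [folklore] -/
theorem opNorm_le_of_rayleigh_le (T : E →L[ℝ] E) (hsym : ∀ x y, ⟪T x, y⟫_ℝ = ⟪x, T y⟫_ℝ)
    (hpos : ∀ x, 0 ≤ ⟪T x, x⟫_ℝ) {M : ℝ} (hM : 0 ≤ M) (hR : ∀ x, ‖x‖ = 1 → ⟪T x, x⟫_ℝ ≤ M) :
    ‖T‖ ≤ M :=
  ContinuousLinearMap.opNorm_le_bound _ hM fun x =>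
    norm_map_le_of_rayleigh_le T hsym hpos (V := Set.univ) (fun _ _ => Set.mem_univ _)
      (fun _ _ _ => Set.mem_univ _) hM (fun x _ hx => hR x hx) (Set.mem_univ x)

/-- The Rayleigh quotient is bounded by the norm: `⟪T x, x⟫ ≤ ‖T‖` for unit `x`. [folklore] -/
theorem rayleigh_le_opNorm (T : E →L[ℝ] E) {x : E} (hx : ‖x‖ = 1) : ⟪T x, x⟫_ℝ ≤ ‖T‖ := by
  calc ⟪T x, x⟫_ℝ ≤ ‖T x‖ * ‖x‖ := real_inner_le_norm _ _
    _ ≤ ‖T‖ * ‖x‖ * ‖x‖ := mul_le_mul_of_nonneg_right (T.le_opNorm x) (norm_nonneg _)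
    _ = ‖T‖ := by rw [hx, mul_one, mul_one]

/-! ### Approximate and exact maximisers -/

/-- **Approximate maximisers of the Rayleigh quotient in an invariant closed subspace.** Let `V`
be `T`-invariant and closed under scalars. If the Rayleigh quotient does NOT approach `‖T‖` on the
unit vectors of `V`, i.e. `⟪T x, x⟫ ≤ ‖T‖ - ε` there for some `ε > 0`, then
`‖T x‖ ≤ max (‖T‖ - ε) 0 · ‖x‖` on `V`. [folklore] -/
theorem norm_map_le_of_rayleigh_le_sub (T : E →L[ℝ] E) (hsym : ∀ x y, ⟪T x, y⟫_ℝ = ⟪x, T y⟫_ℝ)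
    (hpos : ∀ x, 0 ≤ ⟪T x, x⟫_ℝ) {V : Set E} (hV : ∀ x ∈ V, T x ∈ V)
    (hVs : ∀ (c : ℝ), ∀ x ∈ V, c • x ∈ V) {ε : ℝ}
    (hR : ∀ x ∈ V, ‖x‖ = 1 → ⟪T x, x⟫_ℝ ≤ ‖T‖ - ε) {x : E} (hx : x ∈ V) :
    ‖T x‖ ≤ max (‖T‖ - ε) 0 * ‖x‖ :=
  norm_map_le_of_rayleigh_le T hsym hpos hV hVs (le_max_right _ _)
    (fun y hy hy1 => (hR y hy hy1).trans (le_max_left _ _)) hx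

/-- **A maximiser of the Rayleigh quotient is an eigenvector for `‖T‖`**: if `‖x‖ = 1` and
`⟪T x, x⟫ = ‖T‖` then `T x = ‖T‖ x` (`‖Tx - ‖T‖x‖² = ‖Tx‖² - 2‖T‖⟪Tx,x⟫ + ‖T‖² ≤ 0`).
[folklore] -/
theorem eq_smul_of_rayleigh_eq_norm (T : E →L[ℝ] E) {x : E} (hx : ‖x‖ = 1)
    (hmax : ⟪T x, x⟫_ℝ = ‖T‖) : T x = ‖T‖ • x := by
  have h : ‖T x - ‖T‖ • x‖ ^ 2 ≤ 0 := by
    rw [norm_sub_sq_real, inner_smul_right, hmax, norm_smul, Real.norm_eq_abs,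
      abs_of_nonneg (norm_nonneg _), hx, mul_one]
    have hTx : ‖T x‖ ≤ ‖T‖ := by simpa [hx] using T.le_opNorm x
    nlinarith [norm_nonneg (T x), norm_nonneg T]
  have h0 : ‖T x - ‖T‖ • x‖ = 0 := by
    have := sq_nonneg ‖T x - ‖T‖ • x‖
    nlinarith [norm_nonneg (T x - ‖T‖ • x)]
  exact sub_eq_zero.1 (norm_eq_zero.1 h0)

/-- Along an approximately maximising sequence of unit vectors, `T xₙ - ‖T‖ xₙ → 0`. [folklore] -/
theorem tendsto_sub_smul_of_rayleigh (T : E →L[ℝ] E) {x : ℕ → E} (hx : ∀ n, ‖x n‖ = 1)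
    (hR : Tendsto (fun n => ⟪T (x n), x n⟫_ℝ) atTop (𝓝 ‖T‖)) :
    Tendsto (fun n => T (x n) - ‖T‖ • x n) atTop (𝓝 0) := by
  rw [tendsto_zero_iff_norm_tendsto_zero]
  have hb : ∀ n, ‖T (x n) - ‖T‖ • x n‖ ^ 2 ≤ 2 * ‖T‖ * (‖T‖ - ⟪T (x n), x n⟫_ℝ) := by
    intro n
    rw [norm_sub_sq_real, inner_smul_right, norm_smul, Real.norm_eq_abs,
      abs_of_nonneg (norm_nonneg _), hx n, mul_one]
    have hTx : ‖T (x n)‖ ≤ ‖T‖ := by simpa [hx n] using T.le_opNorm (x n)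
    nlinarith [norm_nonneg (T (x n)), norm_nonneg T]
  have hlim : Tendsto (fun n => 2 * ‖T‖ * (‖T‖ - ⟪T (x n), x n⟫_ℝ)) atTop (𝓝 0) := by
    have := ((tendsto_const_nhds (x := ‖T‖)).sub hR).const_mul (2 * ‖T‖)
    simpa using this
  have hsq : Tendsto (fun n => ‖T (x n) - ‖T‖ • x n‖ ^ 2) atTop (𝓝 0) :=
    squeeze_zero (fun n => sq_nonneg _) hb hlim
  have h := (Real.continuous_sqrt.tendsto 0).comp hsq
  rw [Real.sqrt_zero] at h
  refine h.congr fun n => ?_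
  simp [Real.sqrt_sq (norm_nonneg _)]

/-- **Existence of a top eigenvector (compactness).** Let `T ≠ 0` be compact, positive and
symmetric, and `V` a closed `T`-invariant subset closed under scalars on whose unit vectors the
Rayleigh quotient approaches `‖T‖` (for every `ε > 0` some unit `x ∈ V` has
`⟪T x, x⟫ > ‖T‖ - ε`). Then `V` contains a unit eigenvector of `T` for the eigenvalue `‖T‖`
(maximising sequence; a convergent subsequence of `T xₙ`; `‖T‖ xₙ = T xₙ - (T xₙ - ‖T‖ xₙ)`
converges). Reed–Simon I Thm VI.16 / IV Thm XIII.44. [cite: ReedSimonIV1978, Thm XIII.44] -/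
theorem exists_eigenvector_norm_of_isCompactOperator [CompleteSpace E] (T : E →L[ℝ] E)
    (hc : IsCompactOperator T) (hT : T ≠ 0) {V : Set E} (hVc : IsClosed V)
    (happ : ∀ ε > 0, ∃ x ∈ V, ‖x‖ = 1 ∧ ‖T‖ - ε < ⟪T x, x⟫_ℝ) :
    ∃ e ∈ V, ‖e‖ = 1 ∧ T e = ‖T‖ • e := by
  have hTn : 0 < ‖T‖ := norm_pos_iff.2 hT
  -- a maximising sequence of unit vectors of `V`
  choose x hxV hx1 hxR using fun n : ℕ => happ (1 / ((n : ℝ) + 1)) (by positivity)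
  have hR : Tendsto (fun n => ⟪T (x n), x n⟫_ℝ) atTop (𝓝 ‖T‖) := by
    refine tendsto_of_tendsto_of_tendsto_of_le_of_le (g := fun n : ℕ => ‖T‖ - 1 / ((n : ℝ) + 1))
      (h := fun _ => ‖T‖) ?_ tendsto_const_nhds (fun n => (hxR n).le) (fun n => rayleigh_le_opNorm T (hx1 n))
    have := (tendsto_const_nhds (x := ‖T‖)).sub (tendsto_one_div_add_atTop_nhds_zero_nat)
    simpa using this
  have hsub := tendsto_sub_smul_of_rayleigh T hx1 hR
  -- compactness: a convergent subsequence of `T xₙ`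
  obtain ⟨K, hK, hTK⟩ := hc.image_closedBall_subset_compact (𝕜₁ := ℝ) 1
  have hmem : ∀ n, T (x n) ∈ K := fun n =>
    hTK ⟨x n, Metric.mem_closedBall.2 (by simp [hx1 n]), rfl⟩
  obtain ⟨y, -, φ, hφ, hy⟩ := hK.tendsto_subseq hmem
  -- `‖T‖ x_{φ n} → y`, hence `x_{φ n} → ‖T‖⁻¹ y =: e`
  have hx' : Tendsto (fun n => ‖T‖ • x (φ n)) atTop (𝓝 y) := by
    have h := hy.sub (hsub.comp hφ.tendsto_atTop)
    simp only [Function.comp_def, sub_zero] at h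
    refine h.congr fun n => ?_
    simp
  have hxe : Tendsto (fun n => x (φ n)) atTop (𝓝 (‖T‖⁻¹ • y)) := by
    have h := hx'.const_smul ‖T‖⁻¹
    refine h.congr fun n => ?_
    rw [smul_smul, inv_mul_cancel₀ hTn.ne', one_smul]
  refine ⟨‖T‖⁻¹ • y, ?_, ?_, ?_⟩
  · exact hVc.mem_of_tendsto hxe (Eventually.of_forall fun n => hxV (φ n))
  · have h := (continuous_norm.tendsto _).comp hxe
    have h1 : Tendsto (fun n => ‖x (φ n)‖) atTop (𝓝 1) := by simp [hx1]
    exact tendsto_nhds_unique h h1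
  · -- `T e = lim T x_{φ n} = y = ‖T‖ e`
    have h1 : Tendsto (fun n => T (x (φ n))) atTop (𝓝 (T (‖T‖⁻¹ • y))) := (T.continuous.tendsto _).comp hxe
    have h2 : Tendsto (fun n => T (x (φ n))) atTop (𝓝 y) := hy
    rw [tendsto_nhds_unique h1 h2, smul_smul, mul_inv_cancel₀ hTn.ne', one_smul]

/-- **A nonzero compact positive symmetric operator attains its norm as an eigenvalue**: there is
a unit `e` with `T e = ‖T‖ e` (the Rayleigh quotient approaches `‖T‖` on the whole space, else
`‖T‖ ≤ max (‖T‖ - ε) 0 < ‖T‖`). Reed–Simon I Thm VI.16. [cite: ReedSimonIV1978, Thm XIII.44] -/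
theorem exists_eigenvector_norm [CompleteSpace E] (T : E →L[ℝ] E)
    (hsym : ∀ x y, ⟪T x, y⟫_ℝ = ⟪x, T y⟫_ℝ) (hpos : ∀ x, 0 ≤ ⟪T x, x⟫_ℝ)
    (hc : IsCompactOperator T) (hT : T ≠ 0) : ∃ e : E, ‖e‖ = 1 ∧ T e = ‖T‖ • e := by
  have hTn : 0 < ‖T‖ := norm_pos_iff.2 hT
  have happ : ∀ ε > 0, ∃ x ∈ (Set.univ : Set E), ‖x‖ = 1 ∧ ‖T‖ - ε < ⟪T x, x⟫_ℝ := by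
    intro ε hε
    by_contra hcon
    push Not at hcon
    have hb : ∀ x : E, ‖T x‖ ≤ max (‖T‖ - ε) 0 * ‖x‖ := fun x =>
      norm_map_le_of_rayleigh_le_sub T hsym hpos (V := Set.univ) (fun _ _ => Set.mem_univ _)
        (fun _ _ _ => Set.mem_univ _) (fun y hy hy1 => hcon y hy hy1) (Set.mem_univ x)
    have h1 : ‖T‖ ≤ max (‖T‖ - ε) 0 := ContinuousLinearMap.opNorm_le_bound _ (le_max_right _ _) hb
    have h2 : max (‖T‖ - ε) 0 < ‖T‖ := max_lt (by linarith) hTn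
    exact absurd h1 (not_le.2 h2)
  obtain ⟨e, -, he, hTe⟩ := exists_eigenvector_norm_of_isCompactOperator T hc hT isClosed_univ happ
  exact ⟨e, he, hTe⟩

/-! ### The spectral gap below a simple top eigenvalue -/

/-- **Spectral gap.** Let `T ≠ 0` be compact, positive and symmetric with a unit eigenvector `e`
for `‖T‖` spanning that eigenspace. Then there is `M₁ < ‖T‖` (`M₁ ≥ 0`) with `‖T x‖ ≤ M₁ ‖x‖`
for every `x ⊥ e` (otherwise the Rayleigh quotient approaches `‖T‖` on `e^⊥`, a closed
invariant subspace, which would then contain a second unit eigenvector for `‖T‖`).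
Reed–Simon IV Thm XIII.44 (the gap below a nondegenerate ground state). [folklore] -/
theorem exists_gap_of_simple [CompleteSpace E] (T : E →L[ℝ] E)
    (hsym : ∀ x y, ⟪T x, y⟫_ℝ = ⟪x, T y⟫_ℝ) (hpos : ∀ x, 0 ≤ ⟪T x, x⟫_ℝ)
    (hc : IsCompactOperator T) (hT : T ≠ 0) {e : E} (he : ‖e‖ = 1)
    (hTe : T e = ‖T‖ • e) (hsimple : ∀ f, T f = ‖T‖ • f → ∃ c : ℝ, f = c • e) :
    ∃ M₁ < ‖T‖, 0 ≤ M₁ ∧ ∀ x, ⟪e, x⟫_ℝ = 0 → ‖T x‖ ≤ M₁ * ‖x‖ := by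
  have hTn : 0 < ‖T‖ := norm_pos_iff.2 hT
  set V : Set E := {x | ⟪e, x⟫_ℝ = 0} with hV
  have hVc : IsClosed V := isClosed_eq (continuous_const.inner continuous_id) continuous_const
  have hVT : ∀ x ∈ V, T x ∈ V := by
    intro x hx
    simp only [hV, Set.mem_setOf_eq] at hx ⊢
    rw [← hsym, hTe, inner_smul_left, hx]
    simp
  have hVs : ∀ (c : ℝ), ∀ x ∈ V, c • x ∈ V := by
    intro c x hx
    simp only [hV, Set.mem_setOf_eq] at hx ⊢
    rw [inner_smul_right, hx, mul_zero]
  by_cases happ : ∀ ε > 0, ∃ x ∈ V, ‖x‖ = 1 ∧ ‖T‖ - ε < ⟪T x, x⟫_ℝ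
  · -- a second eigenvector in `e^⊥`: impossible
    exfalso
    obtain ⟨f, hfV, hf1, hTf⟩ := exists_eigenvector_norm_of_isCompactOperator T hc hT hVc happ
    obtain ⟨c, rfl⟩ := hsimple f hTf
    have hc0 : c = 0 := by
      have h : ⟪e, c • e⟫_ℝ = 0 := hfV
      rwa [inner_smul_right, real_inner_self_eq_norm_sq, he, one_pow, mul_one] at h
    rw [hc0, zero_smul, norm_zero] at hf1
    exact zero_ne_one hf1
  · push Not at happ
    obtain ⟨ε, hε, hR⟩ := happ
    refine ⟨max (‖T‖ - ε) 0, max_lt (by linarith) hTn, le_max_right _ _, fun x hx => ?_⟩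
    exact norm_map_le_of_rayleigh_le_sub T hsym hpos hVT hVs (fun y hy hy1 => hR y hy hy1) hx

/-- Iterating the gap bound on the invariant subspace `e^⊥`: `‖Tⁿ x‖ ≤ M₁ⁿ ‖x‖` for `x ⊥ e`.
[folklore] -/
theorem norm_iterate_le_of_gap (T : E →L[ℝ] E) (hsym : ∀ x y, ⟪T x, y⟫_ℝ = ⟪x, T y⟫_ℝ)
    {e : E} {μ : ℝ} (hTe : T e = μ • e) {M₁ : ℝ} (hM₁ : 0 ≤ M₁)
    (hgap : ∀ x, ⟪e, x⟫_ℝ = 0 → ‖T x‖ ≤ M₁ * ‖x‖) (n : ℕ) {x : E} (hx : ⟪e, x⟫_ℝ = 0) :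
    ‖(T : E → E)^[n] x‖ ≤ M₁ ^ n * ‖x‖ := by
  have hinv : ∀ y, ⟪e, y⟫_ℝ = 0 → ⟪e, T y⟫_ℝ = 0 := by
    intro y hy
    rw [← hsym, hTe, inner_smul_left, hy]
    simp
  induction n generalizing x with
  | zero => simp
  | succ n ih =>
    rw [Function.iterate_succ_apply', pow_succ]
    have h1 : ⟪e, (T : E → E)^[n] x⟫_ℝ = 0 := by
      clear ih
      induction n with
      | zero => simpa using hx
      | succ m ihm => rw [Function.iterate_succ_apply']; exact hinv _ ihm
    calc ‖T ((T : E → E)^[n] x)‖ ≤ M₁ * ‖(T : E → E)^[n] x‖ := hgap _ h1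
      _ ≤ M₁ * (M₁ ^ n * ‖x‖) := mul_le_mul_of_nonneg_left (ih hx) hM₁
      _ = M₁ ^ n * M₁ * ‖x‖ := by ring

/-! ### Symmetric contraction semigroups with a simple top eigenvalue at time one -/

section Semigroup

variable {S : ℝ → E →L[ℝ] E} {e : E} {μ₀ : ℝ}

/-- **The top eigenvector at time one is an eigenvector at all times**: if `S` is a semigroup
(`S (s+t) = S s ∘ S t` for `s, t > 0`), `S 1 e = μ₀ e` and the `μ₀`-eigenspace of `S 1` is
spanned by `e`, then `S t e = ⟪e, S t e⟫ e` for every `t > 0` (`S t e` is again a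
`μ₀`-eigenvector of `S 1`). Chung–Zhao (1995), §8.3 (29). [folklore] -/
theorem semigroup_apply_eigenvector
    (hadd : ∀ s t : ℝ, 0 < s → 0 < t → S (s + t) = (S s).comp (S t))
    (he : ‖e‖ = 1) (hSe : S 1 e = μ₀ • e) (hsimple : ∀ f, S 1 f = μ₀ • f → ∃ c : ℝ, f = c • e)
    {t : ℝ} (ht : 0 < t) : S t e = ⟪e, S t e⟫_ℝ • e := by
  have hcomm : S 1 (S t e) = μ₀ • S t e := by
    have h1 : (S 1).comp (S t) = (S t).comp (S 1) := by
      rw [← hadd 1 t one_pos ht, ← hadd t 1 ht one_pos, add_comm]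
    have := congrArg (fun F : E →L[ℝ] E => F e) h1
    simp only [ContinuousLinearMap.comp_apply] at this
    rw [this, hSe, map_smul]
  obtain ⟨c, hc⟩ := hsimple _ hcomm
  have : ⟪e, S t e⟫_ℝ = c := by
    rw [hc, inner_smul_right, real_inner_self_eq_norm_sq, he, one_pow, mul_one]
  rw [this, ← hc]

/-- **Multiplicativity of the coefficient** `c(t) = ⟪e, S t e⟫`: `c(s + t) = c(s) c(t)`.
[folklore] -/
theorem coeff_add (hadd : ∀ s t : ℝ, 0 < s → 0 < t → S (s + t) = (S s).comp (S t))
    (he : ‖e‖ = 1) (hSe : S 1 e = μ₀ • e) (hsimple : ∀ f, S 1 f = μ₀ • f → ∃ c : ℝ, f = c • e)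
    {s t : ℝ} (hs : 0 < s) (ht : 0 < t) :
    ⟪e, S (s + t) e⟫_ℝ = ⟪e, S s e⟫_ℝ * ⟪e, S t e⟫_ℝ := by
  rw [hadd s t hs ht, ContinuousLinearMap.comp_apply]
  conv_lhs => rw [semigroup_apply_eigenvector hadd he hSe hsimple ht, map_smul, inner_smul_right]
  ring

/-- `c(n t) = c(t)ⁿ` for positive integers `n`. [folklore] -/
theorem coeff_nat_mul (hadd : ∀ s t : ℝ, 0 < s → 0 < t → S (s + t) = (S s).comp (S t))
    (he : ‖e‖ = 1) (hSe : S 1 e = μ₀ • e) (hsimple : ∀ f, S 1 f = μ₀ • f → ∃ c : ℝ, f = c • e)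
    {t : ℝ} (ht : 0 < t) (n : ℕ) (hn : 0 < n) :
    ⟪e, S (n * t) e⟫_ℝ = ⟪e, S t e⟫_ℝ ^ n := by
  induction n with
  | zero => exact absurd hn (lt_irrefl 0)
  | succ m ih =>
    rcases Nat.eq_zero_or_pos m with rfl | hm
    · simp
    · rw [Nat.cast_succ, add_mul, one_mul, coeff_add hadd he hSe hsimple (by positivity) ht, ih hm,
        pow_succ]

/-- The coefficient at time one is `μ₀`. [folklore] -/
theorem coeff_one (he : ‖e‖ = 1) (hSe : S 1 e = μ₀ • e) : ⟪e, S 1 e⟫_ℝ = μ₀ := by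
  rw [hSe, inner_smul_right, real_inner_self_eq_norm_sq, he, one_pow, mul_one]

/-- **The coefficient is positive**: `c(t) c(n - t) = c(n) = μ₀ⁿ > 0` for an integer `n > t`,
and `c ≥ 0` by positivity of the operators. [folklore] -/
theorem coeff_pos (hadd : ∀ s t : ℝ, 0 < s → 0 < t → S (s + t) = (S s).comp (S t))
    (hpos : ∀ t, 0 < t → ∀ x, 0 ≤ ⟪S t x, x⟫_ℝ)
    (he : ‖e‖ = 1) (hSe : S 1 e = μ₀ • e) (hsimple : ∀ f, S 1 f = μ₀ • f → ∃ c : ℝ, f = c • e)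
    (hμ₀ : 0 < μ₀) {t : ℝ} (ht : 0 < t) : 0 < ⟪e, S t e⟫_ℝ := by
  have hnn : ∀ r, 0 < r → 0 ≤ ⟪e, S r e⟫_ℝ := fun r hr => by rw [real_inner_comm]; exact hpos r hr e
  obtain ⟨n, hn⟩ := exists_nat_gt t
  have hn0 : 0 < n := by exact_mod_cast ht.trans hn
  have hsplit : ⟪e, S t e⟫_ℝ * ⟪e, S (n - t) e⟫_ℝ = μ₀ ^ n := by
    rw [← coeff_add hadd he hSe hsimple ht (by linarith), add_sub_cancel,
      show (n : ℝ) = n * 1 by ring, coeff_nat_mul hadd he hSe hsimple one_pos n hn0, coeff_one he hSe]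
  have hprod : 0 < ⟪e, S t e⟫_ℝ * ⟪e, S (n - t) e⟫_ℝ := by rw [hsplit]; positivity
  rcases (hnn t ht).lt_or_eq with h | h
  · exact h
  · rw [← h, zero_mul] at hprod; exact absurd hprod (lt_irrefl 0)

/-- **The coefficient is at most one** for contractions. [folklore] -/
theorem coeff_le_one (hcontr : ∀ t, 0 < t → ‖S t‖ ≤ 1) (he : ‖e‖ = 1) {t : ℝ} (ht : 0 < t) :
    ⟪e, S t e⟫_ℝ ≤ 1 := by
  calc ⟪e, S t e⟫_ℝ ≤ ‖e‖ * ‖S t e‖ := real_inner_le_norm _ _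
    _ ≤ ‖e‖ * (‖S t‖ * ‖e‖) := mul_le_mul_of_nonneg_left ((S t).le_opNorm e) (norm_nonneg _)
    _ ≤ 1 := by rw [he, one_mul, mul_one]; exact hcontr t ht

/-- **The coefficient is antitone**: `c(s + t) = c(s) c(t) ≤ c(s)`. [folklore] -/
theorem coeff_antitone (hadd : ∀ s t : ℝ, 0 < s → 0 < t → S (s + t) = (S s).comp (S t))
    (hcontr : ∀ t, 0 < t → ‖S t‖ ≤ 1) (hpos : ∀ t, 0 < t → ∀ x, 0 ≤ ⟪S t x, x⟫_ℝ)
    (he : ‖e‖ = 1) (hSe : S 1 e = μ₀ • e) (hsimple : ∀ f, S 1 f = μ₀ • f → ∃ c : ℝ, f = c • e)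
    (hμ₀ : 0 < μ₀) {s t : ℝ} (hs : 0 < s) (hst : s ≤ t) : ⟪e, S t e⟫_ℝ ≤ ⟪e, S s e⟫_ℝ := by
  rcases hst.lt_or_eq with h | rfl
  · have := coeff_add hadd he hSe hsimple hs (sub_pos.2 h)
    rw [add_sub_cancel] at this
    rw [this]
    exact mul_le_of_le_one_right (coeff_pos hadd hpos he hSe hsimple hμ₀ hs).le
      (coeff_le_one hcontr he (sub_pos.2 h))
  · exact le_rfl

/-- **The coefficient on positive rationals**: `c(p/q) = μ₀^{p/q}` (`c(p/q)^q = c(p) = μ₀^p`).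
[folklore] -/
theorem coeff_nat_div (hadd : ∀ s t : ℝ, 0 < s → 0 < t → S (s + t) = (S s).comp (S t))
    (hpos : ∀ t, 0 < t → ∀ x, 0 ≤ ⟪S t x, x⟫_ℝ)
    (he : ‖e‖ = 1) (hSe : S 1 e = μ₀ • e) (hsimple : ∀ f, S 1 f = μ₀ • f → ∃ c : ℝ, f = c • e)
    (hμ₀ : 0 < μ₀) {p q : ℕ} (hp : 0 < p) (hq : 0 < q) :
    ⟪e, S ((p : ℝ) / q) e⟫_ℝ = μ₀ ^ ((p : ℝ) / q) := by
  have hpq : (0 : ℝ) < (p : ℝ) / q := by positivity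
  have h1 : ⟪e, S ((p : ℝ) / q) e⟫_ℝ ^ q = μ₀ ^ p := by
    rw [← coeff_nat_mul hadd he hSe hsimple hpq q hq, mul_div_cancel₀ _ (by positivity : (q : ℝ) ≠ 0),
      show (p : ℝ) = p * 1 by ring, coeff_nat_mul hadd he hSe hsimple one_pos p hp, coeff_one he hSe]
  have h0 : 0 ≤ ⟪e, S ((p : ℝ) / q) e⟫_ℝ := (coeff_pos hadd hpos he hSe hsimple hμ₀ hpq).le
  calc ⟪e, S ((p : ℝ) / q) e⟫_ℝ = (⟪e, S ((p : ℝ) / q) e⟫_ℝ ^ q) ^ ((q : ℝ)⁻¹) :=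
        (Real.pow_rpow_inv_natCast h0 hq.ne').symm
    _ = (μ₀ ^ p) ^ ((q : ℝ)⁻¹) := by rw [h1]
    _ = μ₀ ^ ((p : ℝ) / q) := by
        rw [← Real.rpow_natCast, ← Real.rpow_mul hμ₀.le, div_eq_mul_inv]

/-- **The coefficient is the exponential `c(t) = μ₀ᵗ`** for all `t > 0` (rationals by the previous
lemma; squeeze by monotonicity and continuity of `μ₀^·`). Chung–Zhao (1995), §8.3 (29)
(`T_t φ₁ = e^{λ₁ t} φ₁`). [folklore] -/
theorem coeff_eq_rpow (hadd : ∀ s t : ℝ, 0 < s → 0 < t → S (s + t) = (S s).comp (S t))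
    (hcontr : ∀ t, 0 < t → ‖S t‖ ≤ 1) (hpos : ∀ t, 0 < t → ∀ x, 0 ≤ ⟪S t x, x⟫_ℝ)
    (he : ‖e‖ = 1) (hSe : S 1 e = μ₀ • e) (hsimple : ∀ f, S 1 f = μ₀ • f → ∃ c : ℝ, f = c • e)
    (hμ₀ : 0 < μ₀) {t : ℝ} (ht : 0 < t) : ⟪e, S t e⟫_ℝ = μ₀ ^ t := by
  -- the value at a positive rational
  have hrat : ∀ r : ℚ, 0 < r → ⟪e, S (r : ℝ) e⟫_ℝ = μ₀ ^ (r : ℝ) := by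
    intro r hr
    have hnum : 0 < r.num := Rat.num_pos.2 hr
    have hr' : (r : ℝ) = (r.num.toNat : ℕ) / (r.den : ℕ) := by
      have h1 : ((r.num.toNat : ℕ) : ℤ) = r.num := Int.toNat_of_nonneg hnum.le
      rw [Rat.cast_def]
      congr 1
      exact_mod_cast h1.symm
    rw [hr']
    exact coeff_nat_div hadd hpos he hSe hsimple hμ₀ (by omega) r.den_pos
  have hanti := fun {s t : ℝ} (hs : 0 < s) (hst : s ≤ t) =>
    coeff_antitone hadd hcontr hpos he hSe hsimple hμ₀ hs hst
  have hcont : Continuous fun s : ℝ => μ₀ ^ s := continuous_const.rpow continuous_id fun _ => Or.inl hμ₀.ne'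
  -- squeeze
  refine le_antisymm ?_ ?_
  · -- `c t ≤ μ₀^t`: rationals `r < t` give `c t ≤ c r = μ₀^r`, and `μ₀^r → μ₀^t` as `r ↑ t`
    by_contra hlt
    push Not at hlt
    have hev : ∀ᶠ s in 𝓝 t, μ₀ ^ s < ⟪e, S t e⟫_ℝ := (hcont.tendsto t).eventually (gt_mem_nhds hlt)
    obtain ⟨δ, hδ, hball⟩ := Metric.eventually_nhds_iff.1 hev
    obtain ⟨r, hr1, hr2⟩ := exists_rat_btwn (max_lt (sub_lt_self t (half_pos hδ)) (half_lt_self ht) :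
      max (t - δ / 2) (t / 2) < t)
    have hr0 : (0 : ℝ) < r := (half_pos ht).trans (lt_of_le_of_lt (le_max_right _ _) hr1)
    have hrt : dist (r : ℝ) t < δ := by
      rw [Real.dist_eq, abs_sub_lt_iff]
      constructor <;> linarith [le_max_left (t - δ / 2) (t / 2)]
    have h1 := hball hrt
    rw [← hrat r (by exact_mod_cast hr0)] at h1
    exact absurd (hanti hr0 hr2.le) (not_le.2 h1)
  · by_contra hlt
    push Not at hlt
    have hev : ∀ᶠ s in 𝓝 t, ⟪e, S t e⟫_ℝ < μ₀ ^ s := (hcont.tendsto t).eventually (lt_mem_nhds hlt)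
    obtain ⟨δ, hδ, hball⟩ := Metric.eventually_nhds_iff.1 hev
    obtain ⟨r, hr1, hr2⟩ := exists_rat_btwn (show t < t + δ / 2 by linarith)
    have hr0 : (0 : ℝ) < r := ht.trans hr1
    have hrt : dist (r : ℝ) t < δ := by
      rw [Real.dist_eq, abs_sub_lt_iff]; constructor <;> linarith
    have h1 := hball hrt
    rw [← hrat r (by exact_mod_cast hr0)] at h1
    exact absurd (hanti ht hr1.le) (not_le.2 h1)

/-- **Iterated semigroup law**: `S (n + r) x = (S 1)ⁿ (S r x)` (`r > 0`). [folklore] -/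
theorem semigroup_nat_add (hadd : ∀ s t : ℝ, 0 < s → 0 < t → S (s + t) = (S s).comp (S t))
    {r : ℝ} (hr : 0 < r) (n : ℕ) (x : E) : S (n + r) x = (S 1 : E → E)^[n] (S r x) := by
  induction n with
  | zero => simp
  | succ m ih =>
    rw [Nat.cast_succ, show (m : ℝ) + 1 + r = 1 + (m + r) by ring,
      hadd 1 _ one_pos (by positivity), ContinuousLinearMap.comp_apply, ih,
      Function.iterate_succ_apply']

/-- **Ground-state projection for a symmetric contraction semigroup with compact `S 1` and a
simple top eigenvalue.** Let `S` be a semigroup of positive symmetric contractions, `S 1 ≠ 0`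
compact, `e` a unit eigenvector of `S 1` for `‖S 1‖` spanning that eigenspace. Then for every
`g`, `‖S 1‖^{-t} S t g → ⟪e, g⟫ e` as `t → ∞` (spectral gap on `e^⊥`, `S t e = ‖S 1‖ᵗ e`).
Glimm–Jaffe (1987), (3.4.2); Chung–Zhao (1995), §8.3 (29)–(30).
[cite: GlimmJaffeQP1987, §3.4 (3.4.2)] -/
theorem tendsto_rpow_smul_semigroup [CompleteSpace E]
    (hadd : ∀ s t : ℝ, 0 < s → 0 < t → S (s + t) = (S s).comp (S t))
    (hcontr : ∀ t, 0 < t → ‖S t‖ ≤ 1) (hsym : ∀ t, 0 < t → ∀ x y, ⟪S t x, y⟫_ℝ = ⟪x, S t y⟫_ℝ)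
    (hpos : ∀ t, 0 < t → ∀ x, 0 ≤ ⟪S t x, x⟫_ℝ) (hc1 : IsCompactOperator (S 1)) (hS1 : S 1 ≠ 0)
    (he : ‖e‖ = 1) (hSe : S 1 e = ‖S 1‖ • e)
    (hsimple : ∀ f, S 1 f = ‖S 1‖ • f → ∃ c : ℝ, f = c • e) (g : E) :
    Tendsto (fun t : ℝ => (‖S 1‖ ^ (-t)) • S t g) atTop (𝓝 (⟪e, g⟫_ℝ • e)) := by
  set μ₀ : ℝ := ‖S 1‖ with hμ₀
  have hμ₀pos : 0 < μ₀ := norm_pos_iff.2 hS1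
  have hμ₀one : μ₀ ≤ 1 := hcontr 1 one_pos
  obtain ⟨M₁, hM₁lt, hM₁0, hgap⟩ :=
    exists_gap_of_simple (S 1) (hsym 1 one_pos) (hpos 1 one_pos) hc1 hS1 he hSe hsimple
  -- the orthogonal decomposition `g = ⟪e, g⟫ e + h`
  set h : E := g - ⟪e, g⟫_ℝ • e with hh
  have hh0 : ⟪e, h⟫_ℝ = 0 := by
    rw [hh, inner_sub_right, inner_smul_right, real_inner_self_eq_norm_sq, he, one_pow, mul_one, sub_self]
  have hinv : ∀ r, 0 < r → ∀ y, ⟪e, y⟫_ℝ = 0 → ⟪e, S r y⟫_ℝ = 0 := by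
    intro r hr y hy
    rw [← hsym r hr, semigroup_apply_eigenvector hadd he hSe hsimple hr, inner_smul_left, hy]
    simp
  -- the error term: `μ₀^{-t} S t g - ⟪e, g⟫ e = μ₀^{-t} S t h` for `t > 0`
  have herr : ∀ t, 0 < t → (μ₀ ^ (-t)) • S t g - ⟪e, g⟫_ℝ • e = (μ₀ ^ (-t)) • S t h := by
    intro t ht
    have hg : g = ⟪e, g⟫_ℝ • e + h := by rw [hh]; abel
    have hStg : S t g = (⟪e, g⟫_ℝ * μ₀ ^ t) • e + S t h := by
      conv_lhs => rw [hg]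
      rw [map_add, map_smul, semigroup_apply_eigenvector hadd he hSe hsimple ht,
        coeff_eq_rpow hadd hcontr hpos he hSe hsimple hμ₀pos ht, smul_smul]
    have hcoef : μ₀ ^ (-t) * (⟪e, g⟫_ℝ * μ₀ ^ t) = ⟪e, g⟫_ℝ := by
      rw [mul_left_comm, ← Real.rpow_add hμ₀pos, neg_add_cancel, Real.rpow_zero, mul_one]
    rw [hStg, smul_add, smul_smul, hcoef]
    abel
  -- the bound `‖μ₀^{-t} S t h‖ ≤ (M₁/μ₀)^{⌈t⌉₊ - 1} μ₀⁻¹ ‖h‖`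
  have hbound : ∀ t, 0 < t →
      ‖(μ₀ ^ (-t)) • S t h‖ ≤ (M₁ / μ₀) ^ (⌈t⌉₊ - 1) * (μ₀⁻¹ * ‖h‖) := by
    intro t ht
    set n : ℕ := ⌈t⌉₊ - 1 with hn
    have hn1 : 1 ≤ ⌈t⌉₊ := Nat.one_le_iff_ne_zero.2 (Nat.ceil_pos.2 ht).ne'
    have hnt : (n : ℝ) < t := by
      have h1 : ((⌈t⌉₊ - 1 : ℕ) : ℝ) = ⌈t⌉₊ - 1 := by rw [Nat.cast_sub hn1, Nat.cast_one]
      rw [hn, h1]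
      linarith [Nat.ceil_lt_add_one ht.le]
    have htn1 : t ≤ n + 1 := by
      have h1 : ((⌈t⌉₊ - 1 : ℕ) : ℝ) = ⌈t⌉₊ - 1 := by rw [Nat.cast_sub hn1, Nat.cast_one]
      rw [hn, h1]
      linarith [Nat.le_ceil t]
    set r : ℝ := t - n with hr
    have hr0 : 0 < r := sub_pos.2 hnt
    have hr1 : r ≤ 1 := by rw [hr]; linarith
    have hdecomp : S t h = (S 1 : E → E)^[n] (S r h) := by
      rw [← semigroup_nat_add hadd hr0 n h, hr, add_sub_cancel]
    have hSr : ‖S r h‖ ≤ ‖h‖ := by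
      calc ‖S r h‖ ≤ ‖S r‖ * ‖h‖ := (S r).le_opNorm h
        _ ≤ 1 * ‖h‖ := mul_le_mul_of_nonneg_right (hcontr r hr0) (norm_nonneg _)
        _ = ‖h‖ := one_mul _
    have hiter : ‖S t h‖ ≤ M₁ ^ n * ‖h‖ := by
      rw [hdecomp]
      exact (norm_iterate_le_of_gap (S 1) (hsym 1 one_pos) hSe hM₁0 hgap n (hinv r hr0 h hh0)).trans
        (mul_le_mul_of_nonneg_left hSr (pow_nonneg hM₁0 n))
    have hμt : μ₀ ^ (-t) ≤ μ₀ ^ (-(n : ℝ)) * μ₀⁻¹ := by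
      rw [show -t = -(n : ℝ) + -r by rw [hr]; ring, Real.rpow_add hμ₀pos]
      refine mul_le_mul_of_nonneg_left ?_ (Real.rpow_nonneg hμ₀pos.le _)
      rw [← Real.rpow_neg_one]
      exact Real.rpow_le_rpow_of_exponent_ge hμ₀pos hμ₀one (by linarith)
    rw [norm_smul, Real.norm_eq_abs, abs_of_nonneg (Real.rpow_nonneg hμ₀pos.le _)]
    calc μ₀ ^ (-t) * ‖S t h‖ ≤ (μ₀ ^ (-(n : ℝ)) * μ₀⁻¹) * (M₁ ^ n * ‖h‖) :=
          mul_le_mul hμt hiter (norm_nonneg _) (by positivity)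
      _ = (M₁ / μ₀) ^ n * (μ₀⁻¹ * ‖h‖) := by
          rw [Real.rpow_neg hμ₀pos.le, Real.rpow_natCast, div_pow]
          field_simp
  -- conclusion
  rw [tendsto_iff_norm_sub_tendsto_zero]
  have hq : M₁ / μ₀ < 1 := (div_lt_one hμ₀pos).2 hM₁lt
  have hq0 : 0 ≤ M₁ / μ₀ := div_nonneg hM₁0 hμ₀pos.le
  have hlim : Tendsto (fun t : ℝ => (M₁ / μ₀) ^ (⌈t⌉₊ - 1) * (μ₀⁻¹ * ‖h‖)) atTop (𝓝 0) := by
    have h1 : Tendsto (fun t : ℝ => ⌈t⌉₊ - 1) atTop atTop :=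
      (tendsto_sub_atTop_nat 1).comp (tendsto_nat_ceil_atTop (α := ℝ))
    have h2 := (tendsto_pow_atTop_nhds_zero_of_lt_one hq0 hq).comp h1
    simpa using h2.mul_const (μ₀⁻¹ * ‖h‖)
  refine squeeze_zero' (Eventually.of_forall fun t => norm_nonneg _) ?_ hlim
  filter_upwards [eventually_gt_atTop 0] with t ht
  rw [herr t ht]
  exact hbound t ht

end Semigroup

end Literature.MathematicalPhysics.QuantumManyBody.BoseGas

end
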